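import Mathlib
import HarnessLib
import Summits.NavierStokesRegularity.NavierStokesRegularity.Theses.QuarterLogPincer
import Summits.NavierStokesRegularity.NavierStokesRegularity.Theses.SymmetryModuliCount
import Summits.NavierStokesRegularity.NavierStokesRegularity.Theorems.QuarterLogPincerTypeIQuantSubcubicExpLiouvilleTransfer

/-!
# Crux `QuarterLogPincer.TypeIQuantSubcubicExp` (stmt-NavierStokesRegularity-24077), line `thin_cascade`:
  the crux BY NAME from the thin-cascade Liouville statement, and the typed edge 4050 ⇒ 24077

Lead-prover file (ns-tc-p1 g4, `--supports stmt-NavierStokesRegularity-24077`).  Companion of the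
route-independent `QuarterLogPincerTypeIQuantSubcubicExpLiouvilleTransfer.lean` (S1/S2 at a fixed Type-I
constant, the Liouville ⇒ quantitative transfer, the proved case `M < 1`); this small file is the only
part that imports route files (theses-cone hygiene):

* `typeIQuantSubcubicExp_of_thinCascadeLiouville` — the crux `Theses.QuarterLogPincer.TypeIQuantSubcubicExp`
  BY NAME from the registered statement of S3 `stub_thinCascadeLiouville` alone (sorry-free form of the
  skeleton's composition `TypeIQuantSubcubicExp_of : S1 → I1 → S2 → S3 → crux` with S1, I1, S2 discharged
  by the landed stubs p608901 / p619610 / p624656).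
* `typeIQuantSubcubicExp_of_rateLiouville` — the crux from the rate-class Type-I Liouville statement for
  all constants (`∀ C v, IsTypeIAncientMild C v → v ≡ 0` on `t < 0`).
* `typeIQuantSubcubicExp_of_typeIAncientLiouville` — **EDGE AS TYPED: item stmt-NavierStokesRegularity-4050
  `Theses.SymmetryModuliCount.TypeIAncientLiouville` ((L′) in the KNSS gauge) ⇒ item
  stmt-NavierStokesRegularity-24077 `Theses.QuarterLogPincer.TypeIQuantSubcubicExp`.**

HONEST FRAMING: every theorem here is CONDITIONAL on its explicit hypothesis (S3, resp. the Type-I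
Liouville statement, resp. item 4050 — all OPEN); the crux 24077, its parent `SuperlogCubeRate`, item
4050 and Navier–Stokes regularity remain OPEN; no summit statement is proved by this file.
-/

noncomputable section

-- the summit-side namespace `Summit.NavierStokesRegularity.NavierStokesRegularity.…` (single-conjunct summit,
-- D-0017) repeats a component by design; the dupNamespace linter would flag every declaration.
set_option linter.dupNamespace false

namespace Summit.NavierStokesRegularity.NavierStokesRegularity.Theorems.ThinCascade

open MeasureTheory Set Function Metric Filter Topology
open Literature.Analysis Literature.Analysis.FluidPDE
open Summit.NavierStokesRegularity.NavierStokesRegularity.Cruxes.TypeIQuantSubcubicExp.ThinCascade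

/-! ### The crux by name -/

/-- **The crux from the thin-cascade Liouville statement alone** (sorry-free form of the skeleton's
composition `TypeIQuantSubcubicExp_of : S1 → I1 → S2 → S3 → crux` with S1, I1, S2 discharged by the
landed stubs): if no thin singular Type-I ancient object exists, `TypeIQuantSubcubicExp` holds.  The
hypothesis is exactly the registered signature of S3 `stub_thinCascadeLiouville` (OPEN, the DSS wall);
nothing about it is asserted. [folklore] -/
theorem typeIQuantSubcubicExp_of_thinCascadeLiouville
    (hS3 : ∀ (M q : ℝ) (v : ℝ → EuclideanSpace ℝ (Fin 3) → EuclideanSpace ℝ (Fin 3))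
      (g : EuclideanSpace ℝ (Fin 3) → EuclideanSpace ℝ (Fin 3)), ¬ ThinObject M q v g) :
    Summit.NavierStokesRegularity.NavierStokesRegularity.Theses.QuarterLogPincer.TypeIQuantSubcubicExp :=
  fun M => quantSubcubicExpAt_of_noThinObject M fun q _ v g => hS3 M q v g

/-- **EDGE: the rate-class Type-I Liouville statement (all constants) implies the crux
`TypeIQuantSubcubicExp`.**  CONDITIONAL (explicit hypothesis; the Liouville statement is open for
`M ≥ 1`). [folklore] -/
theorem typeIQuantSubcubicExp_of_rateLiouville
    (hL : ∀ (C : ℝ) (v : ℝ → EuclideanSpace ℝ (Fin 3) → EuclideanSpace ℝ (Fin 3)),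
      IsTypeIAncientMild C v → ∀ t < 0, ∀ x, v t x = 0) :
    Summit.NavierStokesRegularity.NavierStokesRegularity.Theses.QuarterLogPincer.TypeIQuantSubcubicExp :=
  fun M => quantSubcubicExpAt_of_rateLiouville M (hL M)

/-- **EDGE stmt-NavierStokesRegularity-4050 ⇒ stmt-NavierStokesRegularity-24077, AS TYPED.**  The route
item `Theses.SymmetryModuliCount.TypeIAncientLiouville` ((L′) in the KNSS gauge, written out with the
Oseen kernel; it is exactly the Liouville statement for the tree's class `IsTypeIAncientMild` by
`isTypeIAncientMild_iff`) implies the crux `Theses.QuarterLogPincer.TypeIQuantSubcubicExp`.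
CONDITIONAL (explicit hypothesis); item 4050 is OPEN. [folklore] -/
theorem typeIQuantSubcubicExp_of_typeIAncientLiouville
    (h : Summit.NavierStokesRegularity.NavierStokesRegularity.Theses.SymmetryModuliCount.TypeIAncientLiouville) :
    Summit.NavierStokesRegularity.NavierStokesRegularity.Theses.QuarterLogPincer.TypeIQuantSubcubicExp :=
  typeIQuantSubcubicExp_of_rateLiouville fun C v hv => h C v (isTypeIAncientMild_iff.1 hv)

end Summit.NavierStokesRegularity.NavierStokesRegularity.Theorems.ThinCascade

end
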